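import Summits.ABC.ABC.Theses.DefiniteXi
import Literature.NumberTheory.DiophantineGeometry.FreyCurveConductorTwoTwistDichotomyProofs
import Literature.NumberTheory.EllipticCurves.ModularDegreeQuadraticTwistValuation
import Literature.NumberTheory.EllipticCurves.ModularDegreeMinimal
import Summits.BirchSwinnertonDyer.BirchSwinnertonDyer.Theorems.ManinLocalTwoThreeDatumModelChange
import HarnessLib

/-!
# Sketch (stub-ideation k3 · gen 8, HOME FAMILY 3 — probe the extremes) for `stub_primeToSixDegreeBound`
# (P6) of crux `DefiniteXi.SteinbergCore` (stmt-ABC-15024), line `Lines/p6_tamagawa_split.lean`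

Scratch only (planner seat; no Literature facts, no route items).  Gen 8 adds ONE new typed layer to the
k3 record (`SketchStubIdeas3.lean` A–E, `…G4` ladder, `…G5` Mersenne, `…G7` forced primes):

* **G8·1 currency normal form** `stub_iff_stubMin` (PROVED): the stub is a statement about the
  isomorphism-invariant number `minModularDegree (freyCurve a b) N` (tree API
  `Literature/NumberTheory/EllipticCurves/ModularDegreeMinimal.lean`), so every transport lemma
  (`minModularDegree_eq_of_maps`, `minModularDegree_congr_level`) acts on it directly.
* **G8·2 presentation invariance** (both PROVED): `minModularDegree_freyCurve_swap` (literal equality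
  `freyCurve_swap`) and `minModularDegree_freyCurve_translate` (datum transport along the `u = 1`
  change `translate_freyCurve`, via the BSD-side theorem
  `Summit.BirchSwinnertonDyer.BirchSwinnertonDyer.Theorems.ManinLocalTwoThree.exists_modularParametrizationData_smul_of_u_eq_one`
  — folklore API that belongs in `Literature/…/ModularDegreeMinimal.lean`).
* **G8·3 the twist-packet law** behind the census observation "cps(deg_min) is identical across the
  Frey sign/order variants of a triple" (26/26 multi-variant rows of j023896): the variants of
  `E_(a,b)` are its six presentations (isomorphic) and their twists by `−1`
  (`quadraticTwist_freyCurve_neg_one : (freyCurve A B).quadraticTwist (-1) = freyCurve B A`);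
  same-level instance of Watkins' identity `deg_mul_sq_eq_of_swap` and its prime-to-`6` reading
  `cps_deg_eq_of_swap` (both PROVED from the tree's
  `deg_mul_sq_mul_sq_eq_of_quadraticTwist_of_natAbs_eq`, `d = −1`, `C = 1`, + `cps_mul`), the descent
  `stubMin_swap_of_twistPacketLaw` (PROVED), and the cross-level statement `TwistPacketLaw` (Prop; M modulo Delaunay 2003 Thm 1 / Watkins 2002 §2.1, the Manin facts
  `mazur_not_dvd_maninConstant_of_odd` / `abbesUllmo_not_dvd_maninConstant_of_not_dvd_level`, and
  C1♯'s 6-smooth cyclic isogeny).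

Disproof honoured: every statement keeps `0 < ε` (`primeToSixDegreeBound_false_without_eps_pos`,
p163062) and minimality — here in the isogeny-stable form `minModularDegree`
(`primeToSixDegreeBound_false_without_minimality`, p162897, kills exactly the datum-wise reading).
None of this is a step toward CLOSING the stub (verdict unchanged: P6 ≡ `FreyDegreeBound` ≡ abc|Frey
modulo the route's binders); it explains why the prime-to-`6` part is the twist-stable currency and
normalises the stub to one presentation per triple.
-/

set_option linter.dupNamespace false

noncomputable section

open WeierstrassCurve
open Literature.NumberTheory.EllipticCurves Literature.NumberTheory.EllipticCurves.ModularForms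
open Literature.NumberTheory.DiophantineGeometry

namespace Summit.ABC.ABC.Cruxes.SteinbergCore.StubIdeas3G8

/-- The registered stub, verbatim. -/
def Stub : Prop :=
  ∀ ε : ℝ, 0 < ε → ∃ C : ℝ, ∀ a b : ℤ, IsCoprime a b → a * b * (a + b) ≠ 0 → ∀ (N : ℕ) [NeZero N],
    (freyCurve a b).conductorNorm ℤ = N →
    ∀ D : ModularParametrizationData (freyCurve a b) N,
      (∀ D' : ModularParametrizationData (freyCurve a b) N, D.deg ≤ D'.deg) →
      ((D.deg / (ordProj[2] D.deg * ordProj[3] D.deg) : ℕ) : ℝ) ≤ C * (N : ℝ) ^ (2 + ε)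

/-- Certificate: `Stub` is syntactically the registered signature (fully qualified form). -/
example : Stub ↔
    (∀ ε : ℝ, 0 < ε → ∃ C : ℝ, ∀ a b : ℤ, IsCoprime a b → a * b * (a + b) ≠ 0 → ∀ (N : ℕ) [NeZero N],
      (Literature.NumberTheory.EllipticCurves.freyCurve a b).conductorNorm ℤ = N →
      ∀ D : Literature.NumberTheory.EllipticCurves.ModularForms.ModularParametrizationData
        (Literature.NumberTheory.EllipticCurves.freyCurve a b) N,
        (∀ D' : Literature.NumberTheory.EllipticCurves.ModularForms.ModularParametrizationData
          (Literature.NumberTheory.EllipticCurves.freyCurve a b) N, D.deg ≤ D'.deg) →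
        ((D.deg / (ordProj[2] D.deg * ordProj[3] D.deg) : ℕ) : ℝ) ≤ C * (N : ℝ) ^ (2 + ε)) :=
  Iff.rfl

/-- The prime-to-`6` part `cps n = n / (2^{v₂ n} · 3^{v₃ n})`. -/
def cps (n : ℕ) : ℕ := n / (ordProj[2] n * ordProj[3] n)

/-! ## G8·1 — currency normal form: the stub is about `minModularDegree` -/

/-- The stub with the minimal-datum binder replaced by the number `minModularDegree (freyCurve a b) N`
(and `Nonempty` data, the only case in which the stub says anything). -/
def StubMin : Prop :=
  ∀ ε : ℝ, 0 < ε → ∃ C : ℝ, ∀ a b : ℤ, IsCoprime a b → a * b * (a + b) ≠ 0 → ∀ (N : ℕ) [NeZero N],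
    (freyCurve a b).conductorNorm ℤ = N →
    Nonempty (ModularParametrizationData (freyCurve a b) N) →
      ((cps (minModularDegree (freyCurve a b) N) : ℕ) : ℝ) ≤ C * (N : ℝ) ^ (2 + ε)

/-- **G8·1 (PROVED).** `Stub ↔ StubMin` (`exists_minimal_datum`, `deg_eq_minModularDegree_iff`). [folklore] -/
theorem stub_iff_stubMin : Stub ↔ StubMin := by
  constructor
  · intro h ε hε
    obtain ⟨C, hC⟩ := h ε hε
    refine ⟨C, fun a b hab h0 N _ hN hne ↦ ?_⟩
    obtain ⟨D, hD, hDmin⟩ := exists_minimal_datum hne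
    have hdeg : D.deg = minModularDegree (freyCurve a b) N := hD
    have hle := hC a b hab h0 N hN D (fun D' ↦ hDmin D')
    rw [← hdeg]
    exact hle
  · intro h ε hε
    obtain ⟨C, hC⟩ := h ε hε
    refine ⟨C, fun a b hab h0 N _ hN D hDmin ↦ ?_⟩
    have hdeg : D.deg = minModularDegree (freyCurve a b) N := (deg_eq_minModularDegree_iff D).mpr hDmin
    have hle := hC a b hab h0 N hN ⟨D⟩
    change ((cps D.deg : ℕ) : ℝ) ≤ _
    rw [hdeg]
    exact hle

/-! ## G8·2 — the six presentations of `E_(a,b)` have the same minimal degree -/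

/-- **Swap (PROVED):** `E_{B,A} = E_{−A,−B}` is the same equation (`freyCurve_swap`). [folklore] -/
theorem minModularDegree_freyCurve_swap (A B : ℤ) (N : ℕ) [NeZero N] :
    minModularDegree (freyCurve B A) N = minModularDegree (freyCurve (-A) (-B)) N := by
  rw [freyCurve_swap]

/-- **Translation (PROVED):** moving the `2`-torsion point `(A,0)` to the origin (`translate_freyCurve`,
`u = 1`) transports every datum with the same `f, c, L, deg` (BSD-side theorem
`…ManinLocalTwoThree.exists_modularParametrizationData_smul_of_u_eq_one`, which belongs in Literature API),
in both directions (inverse change `(1, −A, 0, 0)`), whence equal minima by `minModularDegree_eq_of_maps`.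
[cite: SilvermanAEC2009, III.1 Table 3.1] -/
theorem minModularDegree_freyCurve_translate {A B : ℤ} (h0 : A * B * (A + B) ≠ 0) (N : ℕ) [NeZero N] :
    minModularDegree (freyCurve (-A) (A + B)) N = minModularDegree (freyCurve A B) N := by
  classical
  -- degree of a datum is invariant under rewriting the curve along an equation of curves
  have key : ∀ (W W' : WeierstrassCurve ℚ) (e : W = W') (D : ModularParametrizationData W N),
      (e ▸ D : ModularParametrizationData W' N).modularDegree = D.modularDegree := by
    intro W W' e D; subst e; rfl
  haveI : (freyCurve A B).IsElliptic := isElliptic_freyCurve h0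
  have h0' : (-A) * (A + B) * (-A + (A + B)) ≠ 0 := by
    have : (-A) * (A + B) * (-A + (A + B)) = -(A * B * (A + B)) := by ring
    rw [this, neg_ne_zero]; exact h0
  haveI : (freyCurve (-A) (A + B)).IsElliptic := isElliptic_freyCurve h0'
  -- the two `u = 1` changes
  set C₁ : VariableChange ℚ := ⟨1, (A : ℚ), 0, 0⟩ with hC₁
  set C₂ : VariableChange ℚ := ⟨1, ((-A : ℤ) : ℚ), 0, 0⟩ with hC₂
  have h1 : C₁ • freyCurve A B = freyCurve (-A) (A + B) := translate_freyCurve A B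
  have h2 : C₂ • freyCurve (-A) (A + B) = freyCurve A B := by
    have h := translate_freyCurve (-A) (A + B)
    have e : freyCurve (- -A) (-A + (A + B)) = freyCurve A B := by
      congr 1 <;> ring
    rw [e] at h
    exact h
  symm
  refine minModularDegree_eq_of_maps
    (Φ := fun D ↦ h1 ▸ Classical.choose
      (Summit.BirchSwinnertonDyer.BirchSwinnertonDyer.Theorems.ManinLocalTwoThree.exists_modularParametrizationData_smul_of_u_eq_one
        (freyCurve A B) D C₁ rfl))
    (Ψ := fun D' ↦ h2 ▸ Classical.choose
      (Summit.BirchSwinnertonDyer.BirchSwinnertonDyer.Theorems.ManinLocalTwoThree.exists_modularParametrizationData_smul_of_u_eq_one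
        (freyCurve (-A) (A + B)) D' C₂ rfl))
    (fun D ↦ ?_) (fun D' ↦ ?_)
  · have hs := Classical.choose_spec
      (Summit.BirchSwinnertonDyer.BirchSwinnertonDyer.Theorems.ManinLocalTwoThree.exists_modularParametrizationData_smul_of_u_eq_one
        (freyCurve A B) D C₁ rfl)
    rw [key]
    exact le_of_eq hs.2.2.2
  · have hs := Classical.choose_spec
      (Summit.BirchSwinnertonDyer.BirchSwinnertonDyer.Theorems.ManinLocalTwoThree.exists_modularParametrizationData_smul_of_u_eq_one
        (freyCurve (-A) (A + B)) D' C₂ rfl)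
    rw [key]
    exact le_of_eq hs.2.2.2

/-! ## G8·3 — the twist-packet law (`E_(b,a) = E_(a,b) ⊗ χ₋₁`) -/

/-- **Same-level Watkins identity for the swap (PROVED from the tree).** If the two curves have the same
`|aₙ|` (e.g. both additive at `2`: `aₙ = 0` for even `n`, `natAbs_LFunction_eq_of_quadraticTwist_neg_one`)
then for ANY data at a common level `deg(D') · c(D)² = deg(D) · c(D')²` (`|d| = 1`, `u = 1`).
[cite: Watkins2002, §2.1 (p. 491)] -/
theorem deg_mul_sq_eq_of_swap {a b : ℤ} (h0 : a * b * (a + b) ≠ 0) {N : ℕ} [NeZero N]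
    (habs : ∀ n : ℕ, ((freyCurve b a).LFunction n).natAbs = ((freyCurve a b).LFunction n).natAbs)
    (D : ModularParametrizationData (freyCurve a b) N)
    (D' : ModularParametrizationData (freyCurve b a) N) :
    (D'.deg : ℝ) * (D.c : ℝ) ^ 2 = (D.deg : ℝ) * (D'.c : ℝ) ^ 2 := by
  haveI := isElliptic_freyCurve h0
  have hW' : (1 : VariableChange ℚ) • (freyCurve a b).quadraticTwist (-1) = freyCurve b a := by
    rw [one_smul, quadraticTwist_freyCurve_neg_one]
  have h := ModularParametrizationData.deg_mul_sq_mul_sq_eq_of_quadraticTwist_of_natAbs_eq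
    (-1 : ℚ) (by norm_num) (1 : VariableChange ℚ) hW' habs D D'
  have hu : (((1 : VariableChange ℚ).u : ℚ) : ℝ) = 1 := by
    rw [VariableChange.one_def]; push_cast; rfl
  rw [hu] at h
  have habs1 : |((-1 : ℚ) : ℝ)| = 1 := by simp
  rw [habs1] at h
  linarith [h]

/-- **TwistPacketLaw (Prop; M modulo named facts — instrument, NOT a step of the closing plan).**
For coprime `a, b` the prime-to-`6` part of the minimal degree of `E_(a,b)` at its conductor equals that
of its `−1`-twist `E_(b,a)` at ITS conductor (the two conductors differ by a power of `2`, Diamond–Kramer;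
`factorization_two_conductorNorm_freyCurve_le_five_or_swap_le_three`).  Mechanism: same level ⇒
`deg_mul_sq_eq_of_swap` + `cps(c) = 1` for minimal data (Manin: `mazur_not_dvd_maninConstant_of_odd` /
`abbesUllmo_not_dvd_maninConstant_of_not_dvd_level`, odd part of a Frey conductor squarefree; the cyclic
isogeny optimal → minimal datum has `6`-smooth degree, C1♯ of gen 2); different levels ⇒ Delaunay's
twist formula (local factor at `2` is `6`-smooth: for a Frey curve good at `2`, `a₂ = ±1`).
Census: identical `cps` on all 26 multi-variant rows of j023896 (`P6Census-j023896.md`).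
[cite: doi:10.5802/jtnb.420, Thm 1 (p. 675); Watkins2002, §2.1] -/
def TwistPacketLaw : Prop :=
  ∀ a b : ℤ, IsCoprime a b → a * b * (a + b) ≠ 0 →
    ∀ (N : ℕ) [NeZero N] (N' : ℕ) [NeZero N'],
      (freyCurve a b).conductorNorm ℤ = N → (freyCurve b a).conductorNorm ℤ = N' →
      Nonempty (ModularParametrizationData (freyCurve a b) N) →
      Nonempty (ModularParametrizationData (freyCurve b a) N') →
        cps (minModularDegree (freyCurve a b) N) = cps (minModularDegree (freyCurve b a) N')

/-- `cps` is multiplicative (PROVED; used to read `deg_mul_sq_eq_of_swap` prime-to-`6`). [folklore] -/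
theorem cps_mul (m n : ℕ) : cps (m * n) = cps m * cps n := by
  have hcps : ∀ k : ℕ, cps k = ordCompl[3] (ordCompl[2] k) := by
    intro k
    have h3 : (ordCompl[2] k).factorization 3 = k.factorization 3 := by
      rw [Nat.factorization_div (Nat.ordProj_dvd k 2)]
      simp [Nat.prime_two.factorization_pow]
    change k / (ordProj[2] k * ordProj[3] k) = k / ordProj[2] k / 3 ^ (ordCompl[2] k).factorization 3
    rw [h3, Nat.div_div_eq_div_mul]
  rw [hcps, hcps, hcps, Nat.ordCompl_mul, Nat.ordCompl_mul]

/-- **Same-level half of the twist-packet law (PROVED modulo its two inputs as hypotheses):** if the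
`|aₙ|` agree and both data have prime-to-`6`-trivial Manin constants (`cps |c| = 1`: Mazur/Abbes–Ullmo for
the optimal curve — the odd part of a Frey conductor is squarefree — transported through a `6`-smooth
isogeny), then the two degrees have the same prime-to-`6` part. [folklore] -/
theorem cps_deg_eq_of_swap {a b : ℤ} (h0 : a * b * (a + b) ≠ 0) {N : ℕ} [NeZero N]
    (habs : ∀ n : ℕ, ((freyCurve b a).LFunction n).natAbs = ((freyCurve a b).LFunction n).natAbs)
    (D : ModularParametrizationData (freyCurve a b) N)
    (D' : ModularParametrizationData (freyCurve b a) N)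
    (hc : cps D.c.natAbs = 1) (hc' : cps D'.c.natAbs = 1) :
    cps D'.deg = cps D.deg := by
  have h := deg_mul_sq_eq_of_swap h0 habs D D'
  -- to `ℕ`
  have hnat : D'.deg * D.c.natAbs ^ 2 = D.deg * D'.c.natAbs ^ 2 := by
    have e1 : ((D.c.natAbs : ℕ) : ℝ) ^ 2 = (D.c : ℝ) ^ 2 := by
      rw [Nat.cast_natAbs, Int.cast_abs, sq_abs]
    have e2 : ((D'.c.natAbs : ℕ) : ℝ) ^ 2 = (D'.c : ℝ) ^ 2 := by
      rw [Nat.cast_natAbs, Int.cast_abs, sq_abs]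
    have h' : ((D'.deg * D.c.natAbs ^ 2 : ℕ) : ℝ) = ((D.deg * D'.c.natAbs ^ 2 : ℕ) : ℝ) := by
      push_cast
      rw [e1, e2]
      exact h
    exact_mod_cast h'
  have hcps := congrArg cps hnat
  rw [cps_mul, cps_mul, sq, sq, cps_mul, cps_mul, hc, hc'] at hcps
  simpa using hcps

/-- **Consequence (PROVED): the stub descends along the swap.**  Under `TwistPacketLaw` the `StubMin`
inequality for `E_(b,a)` follows from the one for `E_(a,b)` with the constant multiplied by `2^{5(2+ε)}`,
because the two conductors satisfy `N' ≤ 2^5 · N` — stated here with that comparison as a hypothesis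
(`hNN'`, the Diamond–Kramer bookkeeping, S). [folklore] -/
theorem stubMin_swap_of_twistPacketLaw (hT : TwistPacketLaw) {ε C : ℝ} (hC : 0 ≤ C) {a b : ℤ}
    (hab : IsCoprime a b) (h0 : a * b * (a + b) ≠ 0) {N N' : ℕ} [NeZero N] [NeZero N']
    (hN : (freyCurve a b).conductorNorm ℤ = N) (hN' : (freyCurve b a).conductorNorm ℤ = N')
    (hne : Nonempty (ModularParametrizationData (freyCurve a b) N))
    (hne' : Nonempty (ModularParametrizationData (freyCurve b a) N'))
    (hNN' : (N : ℝ) ≤ 2 ^ 5 * (N' : ℝ)) (hε : 0 ≤ 2 + ε)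
    (h : ((cps (minModularDegree (freyCurve a b) N) : ℕ) : ℝ) ≤ C * (N : ℝ) ^ (2 + ε)) :
    ((cps (minModularDegree (freyCurve b a) N') : ℕ) : ℝ) ≤
      (C * (2 ^ 5) ^ (2 + ε)) * (N' : ℝ) ^ (2 + ε) := by
  rw [← hT a b hab h0 N N' hN hN' hne hne']
  have hN'0 : (0 : ℝ) ≤ (N' : ℝ) := by positivity
  calc ((cps (minModularDegree (freyCurve a b) N) : ℕ) : ℝ) ≤ C * (N : ℝ) ^ (2 + ε) := h
    _ ≤ C * ((2 : ℝ) ^ 5 * (N' : ℝ)) ^ (2 + ε) := by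
        gcongr
    _ = (C * (2 ^ 5) ^ (2 + ε)) * (N' : ℝ) ^ (2 + ε) := by
        rw [Real.mul_rpow (by positivity) hN'0]; ring

end Summit.ABC.ABC.Cruxes.SteinbergCore.StubIdeas3G8

end
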